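import Mathlib

/-!
# LINE `valuative_door` (crux `WeakLifting`, stmt-ValiantsHypothesis-19561) — arithmetic core of the SHARPNESS of the general width-two
# Sidon row: the tropical inequalities of the two-staircase family `d_i = 2^i`, `ord a_i = (32i+64)2^i`, `ord b_i = (32i+104)2^i`,
# `ord c_i = (32i+29)2^i`, `ord e_i = (32i+43)2^i` (letters `[[a, b], [c, e]]`)

HONEST FRAMING.  Helper (cell `pub-symmetroid`, seat val-sym-lift-p1 g23, 2026-08-29; `--supports 19561 --as helper`).  Pure `ℕ`-arithmetic for
the sequel `…ValuativeDoorGenTwoSharp` (for every `K` a GENERAL `2 × 2` Sidon pencil with `4K − 6` dominant exponents, matching the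
`v 2 = 1` row `…GenTwoUnitTwoLaw.valGenSidonTwo_unitTwo_unfolded` `npEdges ≤ 4K − 7`).  The dominant exponents are the four BANDS
`2^k + 2^{k+f}`, `f = 0, 1, 2, 3`, realised by the products `a_k e_{k+f}` (`f = 0, 1`) and `b_k c_{k+f}` (`f = 2, 3`) at the integer slopes
`32k + 98`, `32k + 120`, `32k + 140`, `32k + 166`; dominance of the target `(n, E)` at slope `s` against a competitor term `(e, E')` is
`n + s·E' < e + s·E`, and each splits into two one-letter bounds `M·(32k + c₁)·2^p ≤ M·(32p + c₀)·2^p + c₂·2^k` (`oneLetter32_le/lt`).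
Design (located, `exp/genfamily*.py`, exact check `K ≤ 24`): Gauss-norm picture `‖det‖ = max(‖α‖‖ε‖, ‖β‖‖γ‖)` with TWO staircases —
`(a, e)` hugging the diagonal (breakpoints `32j+96` / `32j+75`) and `(b, c)` offset by two–three letters (`32j+136` / `32j+61`).
Calibration arithmetic only; no bearing on vW / vB, `TropicalB`, `MatrixDescartes` (18050) or VP ≠ VNP.  [elementary]
-/

set_option linter.dupNamespace false
set_option autoImplicit false

namespace Summit.ValiantsHypothesis.ValiantsHypothesis.Theorems.KPlusLogSqLaw.ValDoor

/-! ## §1 The generic two-branch bound (slope step `32`, multiplier `M`) -/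

/-- **generic one-letter bound** `M(32k + c₁)·2^p ≤ M(32p + c₀)·2^p + c₂·2^k` from the two branch hypotheses. [elementary] -/
theorem oneLetter32_le (M c₀ c₁ c₂ : ℕ) (h1 : ∀ t : ℕ, M * c₁ * 2 ^ t ≤ M * (32 * t + c₀) * 2 ^ t + c₂)
    (h2 : ∀ t : ℕ, M * (32 * t + c₁) ≤ M * c₀ + c₂ * 2 ^ t) (k p : ℕ) :
    M * (32 * k + c₁) * 2 ^ p ≤ M * (32 * p + c₀) * 2 ^ p + c₂ * 2 ^ k := by
  rcases le_total k p with hkp | hpk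
  · obtain ⟨t, rfl⟩ := Nat.exists_eq_add_of_le hkp
    have h := Nat.mul_le_mul_left (2 ^ k) (h1 t)
    rw [pow_add]
    have hk : 0 < 2 ^ k := Nat.two_pow_pos k
    nlinarith [h]
  · obtain ⟨t, rfl⟩ := Nat.exists_eq_add_of_le hpk
    have h := Nat.mul_le_mul_left (2 ^ p) (h2 t)
    rw [pow_add]
    nlinarith [h]

/-- **generic one-letter bound, strict off the touching index `p = k + t₀`.** [elementary] -/
theorem oneLetter32_lt (M c₀ c₁ c₂ t₀ : ℕ) (h1 : ∀ t : ℕ, t ≠ t₀ → M * c₁ * 2 ^ t < M * (32 * t + c₀) * 2 ^ t + c₂)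
    (h2 : ∀ t : ℕ, 1 ≤ t → M * (32 * t + c₁) < M * c₀ + c₂ * 2 ^ t) (k p : ℕ) (hp : p ≠ k + t₀) :
    M * (32 * k + c₁) * 2 ^ p < M * (32 * p + c₀) * 2 ^ p + c₂ * 2 ^ k := by
  rcases le_total k p with hkp | hpk
  · obtain ⟨t, rfl⟩ := Nat.exists_eq_add_of_le hkp
    have ht : t ≠ t₀ := fun h => hp (by rw [h])
    have h := Nat.mul_lt_mul_of_pos_left (h1 t ht) (Nat.two_pow_pos k)
    rw [pow_add]
    nlinarith [h]
  · obtain ⟨t, rfl⟩ := Nat.exists_eq_add_of_le hpk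
    rcases Nat.eq_zero_or_pos t with rfl | ht
    · have ht : (0 : ℕ) ≠ t₀ := fun h => hp (by omega)
      have h := Nat.mul_lt_mul_of_pos_left (h1 0 ht) (Nat.two_pow_pos p)
      simp only [pow_zero, mul_one, Nat.mul_zero, Nat.zero_add, Nat.add_zero] at h ⊢
      nlinarith [h]
    · have h := Nat.mul_lt_mul_of_pos_left (h2 t ht) (Nat.two_pow_pos p)
      rw [pow_add]
      nlinarith [h]

/-! ## §2 The sixteen one-letter instances (letters `A = 64`, `E = 43`, `B = 104`, `C = 29`; slopes `98, 120, 140, 166`) -/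

/-- `g0A`: `(32k+98)·2^p ≤ (32p+64)·2^p + 34·2^k` (letter `A`, slope `32k+98`). -/
theorem g0A_le (k p : ℕ) : 1 * (32 * k + 98) * 2 ^ p ≤ 1 * (32 * p + 64) * 2 ^ p + 34 * 2 ^ k := by
  refine oneLetter32_le 1 64 98 34 (fun t => ?_) (fun t => ?_) k p
  · by_cases ht : 2 ≤ t
    · have : 1 * 98 ≤ 1 * (32 * t + 64) := by omega
      nlinarith [Nat.mul_le_mul_right (2 ^ t) this]
    · interval_cases t <;> norm_num
  · have := Nat.lt_two_pow_self (n := t)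
    nlinarith

/-- `g0A`, strict form off `p = k + 0`. -/
theorem g0A_lt (k p : ℕ) (hp : p ≠ k + 0) : 1 * (32 * k + 98) * 2 ^ p < 1 * (32 * p + 64) * 2 ^ p + 34 * 2 ^ k := by
  refine oneLetter32_lt 1 64 98 34 0 (fun t ht => ?_) (fun t ht => ?_) k p hp
  · by_cases ht2 : 2 ≤ t
    · have : 1 * 98 < 1 * (32 * t + 64) := by omega
      nlinarith [Nat.mul_lt_mul_of_pos_right this (Nat.two_pow_pos t)]
    · interval_cases t
      · exact absurd rfl ht
      · norm_num
  · have := Nat.lt_two_pow_self (n := t)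
    nlinarith

/-- `g0E`: `(32k+98)·2^p ≤ (32p+43)·2^p + 55·2^k` (letter `E`, slope `32k+98`). -/
theorem g0E_le (k p : ℕ) : 1 * (32 * k + 98) * 2 ^ p ≤ 1 * (32 * p + 43) * 2 ^ p + 55 * 2 ^ k := by
  refine oneLetter32_le 1 43 98 55 (fun t => ?_) (fun t => ?_) k p
  · by_cases ht : 2 ≤ t
    · have : 1 * 98 ≤ 1 * (32 * t + 43) := by omega
      nlinarith [Nat.mul_le_mul_right (2 ^ t) this]
    · interval_cases t <;> norm_num
  · have := Nat.lt_two_pow_self (n := t)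
    nlinarith

/-- `g0E`, strict form off `p = k + 0`. -/
theorem g0E_lt (k p : ℕ) (hp : p ≠ k + 0) : 1 * (32 * k + 98) * 2 ^ p < 1 * (32 * p + 43) * 2 ^ p + 55 * 2 ^ k := by
  refine oneLetter32_lt 1 43 98 55 0 (fun t ht => ?_) (fun t ht => ?_) k p hp
  · by_cases ht2 : 2 ≤ t
    · have : 1 * 98 < 1 * (32 * t + 43) := by omega
      nlinarith [Nat.mul_lt_mul_of_pos_right this (Nat.two_pow_pos t)]
    · interval_cases t
      · exact absurd rfl ht
      · norm_num
  · have := Nat.lt_two_pow_self (n := t)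
    nlinarith

/-- `g0B`: `2·(32k+98)·2^p ≤ 2·(32p+104)·2^p + 29·2^k` (letter `B`, slope `32k+98`). -/
theorem g0B_le (k p : ℕ) : 2 * (32 * k + 98) * 2 ^ p ≤ 2 * (32 * p + 104) * 2 ^ p + 29 * 2 ^ k := by
  refine oneLetter32_le 2 104 98 29 (fun t => ?_) (fun t => ?_) k p
  · have : 2 * 98 ≤ 2 * (32 * t + 104) := by omega
    nlinarith [Nat.mul_le_mul_right (2 ^ t) this]
  · rcases lt_or_ge t 6 with ht6 | ht6
    · interval_cases t <;> norm_num
    · obtain ⟨u, rfl⟩ := Nat.exists_eq_add_of_le' ht6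
      have hu := Nat.lt_two_pow_self (n := u)
      rw [pow_add]
      nlinarith [hu]

/-- `g0C`: `(32k+98)·2^p ≤ (32p+29)·2^p + 74·2^k` (letter `C`, slope `32k+98`). -/
theorem g0C_le (k p : ℕ) : 1 * (32 * k + 98) * 2 ^ p ≤ 1 * (32 * p + 29) * 2 ^ p + 74 * 2 ^ k := by
  refine oneLetter32_le 1 29 98 74 (fun t => ?_) (fun t => ?_) k p
  · by_cases ht : 3 ≤ t
    · have : 1 * 98 ≤ 1 * (32 * t + 29) := by omega
      nlinarith [Nat.mul_le_mul_right (2 ^ t) this]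
    · interval_cases t <;> norm_num
  · have := Nat.lt_two_pow_self (n := t)
    nlinarith

/-- `g1A`: `(32k+120)·2^p ≤ (32p+64)·2^p + 56·2^k` (letter `A`, slope `32k+120`). -/
theorem g1A_le (k p : ℕ) : 1 * (32 * k + 120) * 2 ^ p ≤ 1 * (32 * p + 64) * 2 ^ p + 56 * 2 ^ k := by
  refine oneLetter32_le 1 64 120 56 (fun t => ?_) (fun t => ?_) k p
  · by_cases ht : 2 ≤ t
    · have : 1 * 120 ≤ 1 * (32 * t + 64) := by omega
      nlinarith [Nat.mul_le_mul_right (2 ^ t) this]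
    · interval_cases t <;> norm_num
  · have := Nat.lt_two_pow_self (n := t)
    nlinarith

/-- `g1A`, strict form off `p = k + 0`. -/
theorem g1A_lt (k p : ℕ) (hp : p ≠ k + 0) : 1 * (32 * k + 120) * 2 ^ p < 1 * (32 * p + 64) * 2 ^ p + 56 * 2 ^ k := by
  refine oneLetter32_lt 1 64 120 56 0 (fun t ht => ?_) (fun t ht => ?_) k p hp
  · by_cases ht2 : 2 ≤ t
    · have : 1 * 120 < 1 * (32 * t + 64) := by omega
      nlinarith [Nat.mul_lt_mul_of_pos_right this (Nat.two_pow_pos t)]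
    · interval_cases t
      · exact absurd rfl ht
      · norm_num
  · have := Nat.lt_two_pow_self (n := t)
    nlinarith

/-- `g1E`: `(32k+120)·2^p ≤ (32p+43)·2^p + 90·2^k` (letter `E`, slope `32k+120`). -/
theorem g1E_le (k p : ℕ) : 1 * (32 * k + 120) * 2 ^ p ≤ 1 * (32 * p + 43) * 2 ^ p + 90 * 2 ^ k := by
  refine oneLetter32_le 1 43 120 90 (fun t => ?_) (fun t => ?_) k p
  · by_cases ht : 3 ≤ t
    · have : 1 * 120 ≤ 1 * (32 * t + 43) := by omega
      nlinarith [Nat.mul_le_mul_right (2 ^ t) this]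
    · interval_cases t <;> norm_num
  · have := Nat.lt_two_pow_self (n := t)
    nlinarith

/-- `g1E`, strict form off `p = k + 1`. -/
theorem g1E_lt (k p : ℕ) (hp : p ≠ k + 1) : 1 * (32 * k + 120) * 2 ^ p < 1 * (32 * p + 43) * 2 ^ p + 90 * 2 ^ k := by
  refine oneLetter32_lt 1 43 120 90 1 (fun t ht => ?_) (fun t ht => ?_) k p hp
  · by_cases ht2 : 3 ≤ t
    · have : 1 * 120 < 1 * (32 * t + 43) := by omega
      nlinarith [Nat.mul_lt_mul_of_pos_right this (Nat.two_pow_pos t)]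
    · interval_cases t
      · norm_num
      · exact absurd rfl ht
      · norm_num
  · have := Nat.lt_two_pow_self (n := t)
    nlinarith

/-- `g1B`: `(32k+120)·2^p ≤ (32p+104)·2^p + 24·2^k` (letter `B`, slope `32k+120`). -/
theorem g1B_le (k p : ℕ) : 1 * (32 * k + 120) * 2 ^ p ≤ 1 * (32 * p + 104) * 2 ^ p + 24 * 2 ^ k := by
  refine oneLetter32_le 1 104 120 24 (fun t => ?_) (fun t => ?_) k p
  · by_cases ht : 1 ≤ t
    · have : 1 * 120 ≤ 1 * (32 * t + 104) := by omega
      nlinarith [Nat.mul_le_mul_right (2 ^ t) this]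
    · interval_cases t; norm_num
  · rcases lt_or_ge t 6 with ht6 | ht6
    · interval_cases t <;> norm_num
    · obtain ⟨u, rfl⟩ := Nat.exists_eq_add_of_le' ht6
      have hu := Nat.lt_two_pow_self (n := u)
      rw [pow_add]
      nlinarith [hu]

/-- `g1C`: `(32k+120)·2^p ≤ (32p+29)·2^p + 118·2^k` (letter `C`, slope `32k+120`). -/
theorem g1C_le (k p : ℕ) : 1 * (32 * k + 120) * 2 ^ p ≤ 1 * (32 * p + 29) * 2 ^ p + 118 * 2 ^ k := by
  refine oneLetter32_le 1 29 120 118 (fun t => ?_) (fun t => ?_) k p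
  · by_cases ht : 3 ≤ t
    · have : 1 * 120 ≤ 1 * (32 * t + 29) := by omega
      nlinarith [Nat.mul_le_mul_right (2 ^ t) this]
    · interval_cases t <;> norm_num
  · have := Nat.lt_two_pow_self (n := t)
    nlinarith

/-- `g2A`: `(32k+140)·2^p ≤ (32p+64)·2^p + 88·2^k` (letter `A`, slope `32k+140`). -/
theorem g2A_le (k p : ℕ) : 1 * (32 * k + 140) * 2 ^ p ≤ 1 * (32 * p + 64) * 2 ^ p + 88 * 2 ^ k := by
  refine oneLetter32_le 1 64 140 88 (fun t => ?_) (fun t => ?_) k p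
  · by_cases ht : 3 ≤ t
    · have : 1 * 140 ≤ 1 * (32 * t + 64) := by omega
      nlinarith [Nat.mul_le_mul_right (2 ^ t) this]
    · interval_cases t <;> norm_num
  · have := Nat.lt_two_pow_self (n := t)
    nlinarith

/-- `g2E`: `(32k+140)·2^p ≤ (32p+43)·2^p + 132·2^k` (letter `E`, slope `32k+140`). -/
theorem g2E_le (k p : ℕ) : 1 * (32 * k + 140) * 2 ^ p ≤ 1 * (32 * p + 43) * 2 ^ p + 132 * 2 ^ k := by
  refine oneLetter32_le 1 43 140 132 (fun t => ?_) (fun t => ?_) k p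
  · by_cases ht : 4 ≤ t
    · have : 1 * 140 ≤ 1 * (32 * t + 43) := by omega
      nlinarith [Nat.mul_le_mul_right (2 ^ t) this]
    · interval_cases t <;> norm_num
  · have := Nat.lt_two_pow_self (n := t)
    nlinarith

/-- `g2B`: `(32k+140)·2^p ≤ (32p+104)·2^p + 36·2^k` (letter `B`, slope `32k+140`). -/
theorem g2B_le (k p : ℕ) : 1 * (32 * k + 140) * 2 ^ p ≤ 1 * (32 * p + 104) * 2 ^ p + 36 * 2 ^ k := by
  refine oneLetter32_le 1 104 140 36 (fun t => ?_) (fun t => ?_) k p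
  · by_cases ht : 2 ≤ t
    · have : 1 * 140 ≤ 1 * (32 * t + 104) := by omega
      nlinarith [Nat.mul_le_mul_right (2 ^ t) this]
    · interval_cases t <;> norm_num
  · have := Nat.lt_two_pow_self (n := t)
    nlinarith

/-- `g2B`, strict form off `p = k + 0`. -/
theorem g2B_lt (k p : ℕ) (hp : p ≠ k + 0) : 1 * (32 * k + 140) * 2 ^ p < 1 * (32 * p + 104) * 2 ^ p + 36 * 2 ^ k := by
  refine oneLetter32_lt 1 104 140 36 0 (fun t ht => ?_) (fun t ht => ?_) k p hp
  · by_cases ht2 : 2 ≤ t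
    · have : 1 * 140 < 1 * (32 * t + 104) := by omega
      nlinarith [Nat.mul_lt_mul_of_pos_right this (Nat.two_pow_pos t)]
    · interval_cases t
      · exact absurd rfl ht
      · norm_num
  · have := Nat.lt_two_pow_self (n := t)
    nlinarith

/-- `g2C`: `(32k+140)·2^p ≤ (32p+29)·2^p + 188·2^k` (letter `C`, slope `32k+140`). -/
theorem g2C_le (k p : ℕ) : 1 * (32 * k + 140) * 2 ^ p ≤ 1 * (32 * p + 29) * 2 ^ p + 188 * 2 ^ k := by
  refine oneLetter32_le 1 29 140 188 (fun t => ?_) (fun t => ?_) k p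
  · by_cases ht : 4 ≤ t
    · have : 1 * 140 ≤ 1 * (32 * t + 29) := by omega
      nlinarith [Nat.mul_le_mul_right (2 ^ t) this]
    · interval_cases t <;> norm_num
  · have := Nat.lt_two_pow_self (n := t)
    nlinarith

/-- `g2C`, strict form off `p = k + 2`. -/
theorem g2C_lt (k p : ℕ) (hp : p ≠ k + 2) : 1 * (32 * k + 140) * 2 ^ p < 1 * (32 * p + 29) * 2 ^ p + 188 * 2 ^ k := by
  refine oneLetter32_lt 1 29 140 188 2 (fun t ht => ?_) (fun t ht => ?_) k p hp
  · by_cases ht2 : 4 ≤ t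
    · have : 1 * 140 < 1 * (32 * t + 29) := by omega
      nlinarith [Nat.mul_lt_mul_of_pos_right this (Nat.two_pow_pos t)]
    · interval_cases t
      · norm_num
      · norm_num
      · exact absurd rfl ht
      · norm_num
  · have := Nat.lt_two_pow_self (n := t)
    nlinarith

/-- `g3A`: `(32k+166)·2^p ≤ (32p+64)·2^p + 152·2^k` (letter `A`, slope `32k+166`). -/
theorem g3A_le (k p : ℕ) : 1 * (32 * k + 166) * 2 ^ p ≤ 1 * (32 * p + 64) * 2 ^ p + 152 * 2 ^ k := by
  refine oneLetter32_le 1 64 166 152 (fun t => ?_) (fun t => ?_) k p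
  · by_cases ht : 4 ≤ t
    · have : 1 * 166 ≤ 1 * (32 * t + 64) := by omega
      nlinarith [Nat.mul_le_mul_right (2 ^ t) this]
    · interval_cases t <;> norm_num
  · have := Nat.lt_two_pow_self (n := t)
    nlinarith

/-- `g3E`: `(32k+166)·2^p ≤ (32p+43)·2^p + 236·2^k` (letter `E`, slope `32k+166`). -/
theorem g3E_le (k p : ℕ) : 1 * (32 * k + 166) * 2 ^ p ≤ 1 * (32 * p + 43) * 2 ^ p + 236 * 2 ^ k := by
  refine oneLetter32_le 1 43 166 236 (fun t => ?_) (fun t => ?_) k p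
  · by_cases ht : 4 ≤ t
    · have : 1 * 166 ≤ 1 * (32 * t + 43) := by omega
      nlinarith [Nat.mul_le_mul_right (2 ^ t) this]
    · interval_cases t <;> norm_num
  · have := Nat.lt_two_pow_self (n := t)
    nlinarith

/-- `g3B`: `(32k+166)·2^p ≤ (32p+104)·2^p + 62·2^k` (letter `B`, slope `32k+166`). -/
theorem g3B_le (k p : ℕ) : 1 * (32 * k + 166) * 2 ^ p ≤ 1 * (32 * p + 104) * 2 ^ p + 62 * 2 ^ k := by
  refine oneLetter32_le 1 104 166 62 (fun t => ?_) (fun t => ?_) k p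
  · by_cases ht : 2 ≤ t
    · have : 1 * 166 ≤ 1 * (32 * t + 104) := by omega
      nlinarith [Nat.mul_le_mul_right (2 ^ t) this]
    · interval_cases t <;> norm_num
  · have := Nat.lt_two_pow_self (n := t)
    nlinarith

/-- `g3B`, strict form off `p = k + 0`. -/
theorem g3B_lt (k p : ℕ) (hp : p ≠ k + 0) : 1 * (32 * k + 166) * 2 ^ p < 1 * (32 * p + 104) * 2 ^ p + 62 * 2 ^ k := by
  refine oneLetter32_lt 1 104 166 62 0 (fun t ht => ?_) (fun t ht => ?_) k p hp
  · by_cases ht2 : 2 ≤ t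
    · have : 1 * 166 < 1 * (32 * t + 104) := by omega
      nlinarith [Nat.mul_lt_mul_of_pos_right this (Nat.two_pow_pos t)]
    · interval_cases t
      · exact absurd rfl ht
      · norm_num
  · have := Nat.lt_two_pow_self (n := t)
    nlinarith

/-- `g3C`: `(32k+166)·2^p ≤ (32p+29)·2^p + 328·2^k` (letter `C`, slope `32k+166`). -/
theorem g3C_le (k p : ℕ) : 1 * (32 * k + 166) * 2 ^ p ≤ 1 * (32 * p + 29) * 2 ^ p + 328 * 2 ^ k := by
  refine oneLetter32_le 1 29 166 328 (fun t => ?_) (fun t => ?_) k p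
  · by_cases ht : 5 ≤ t
    · have : 1 * 166 ≤ 1 * (32 * t + 29) := by omega
      nlinarith [Nat.mul_le_mul_right (2 ^ t) this]
    · interval_cases t <;> norm_num
  · have := Nat.lt_two_pow_self (n := t)
    nlinarith

/-- `g3C`, strict form off `p = k + 3`. -/
theorem g3C_lt (k p : ℕ) (hp : p ≠ k + 3) : 1 * (32 * k + 166) * 2 ^ p < 1 * (32 * p + 29) * 2 ^ p + 328 * 2 ^ k := by
  refine oneLetter32_lt 1 29 166 328 3 (fun t ht => ?_) (fun t ht => ?_) k p hp
  · by_cases ht2 : 5 ≤ t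
    · have : 1 * 166 < 1 * (32 * t + 29) := by omega
      nlinarith [Nat.mul_lt_mul_of_pos_right this (Nat.two_pow_pos t)]
    · interval_cases t
      · norm_num
      · norm_num
      · norm_num
      · exact absurd rfl ht
      · norm_num
  · have := Nat.lt_two_pow_self (n := t)
    nlinarith

end Summit.ValiantsHypothesis.ValiantsHypothesis.Theorems.KPlusLogSqLaw.ValDoor
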